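import Mathlib
import Summits.Ventures.PercRepro2.Defs
import Summits.Ventures.PercRepro2.Independence
import Summits.Ventures.PercRepro2.Harris
import Summits.Ventures.PercRepro2.Graph
import Summits.Ventures.PercRepro2.Exploration
import Summits.Ventures.PercRepro2.Events
import Summits.Ventures.PercRepro2.FourFunctions
import Summits.Ventures.PercRepro2.Induced
import Summits.Ventures.PercRepro2.Frontier
import Summits.Ventures.PercRepro2.ObsIndependence
import Summits.Ventures.PercRepro2.BHK
import Summits.Ventures.PercRepro2.BHKEvents
import Summits.Ventures.PercRepro2.OrderPreservation
import Summits.Ventures.PercRepro2.OrderPreservationQuant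
import Summits.Ventures.PercRepro2.Merge

/-!
# Quantitative R10 for the union cluster `Ũ = C(a₂) ∪ C(a₃)` (blind cell PercRepro2, p1)

The one-root bound `orderPreserving_quant` holds for every edge-endpoint map, in particular for
typer-1's merged graph `G′ = G/(a₂ = a₃)` (`mergeEnds ends a₃ a₂`, same edge set, same measure),
whose cluster of `a₂` is the union cluster `Ũ` of `G` (`mem_cluster_merge_iff`) and whose
connections are `x ↔′ y ⟺ x ↔ y ∨ (x, y ∈ Ũ)` (`conn_merge_iff`; all vertices `≠ a₃`). Transporting
the events gives, with `{x ∈ Ũ} = {x ↔ a₂} ∪ {x ↔ a₃}` and `{x | y} = {x, y ∈ Ũ, x ↮ y}`: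

  `P(o ∈ Ũ, b ∈ Ũ, a₁ ∉ Ũ) − P(o ∈ Ũ, a₁ ∉ Ũ, a₁ ↔ b) ≥
     P(o ∈ Ũ | a₁ ∉ Ũ) · (P(b ∈ Ũ) − P(a₁ ↔ b) − P(a₁ | b))`

— mine-2's `hquant` in `UnionCluster.r2prime3_of_quant_of_SC` (LEAD-PROOFSHAPES §8.9 ADDENDUM 6),
verbatim (`inU ends a₂ a₃ x` unfolds to `connEvent ends x a₂ ∪ connEvent ends x a₃`).
-/

namespace Summit.Ventures.PercRepro2

section Union

variable {V : Type*} {E : Type*} [Fintype E] [DecidableEq E] [Fintype V] [DecidableEq V]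
  {R : Type*} [Field R] [LinearOrder R] [IsStrictOrderedRing R]

omit [Fintype E] [DecidableEq E] [Fintype V] in
/-- `{a₂ ↔′ x} = {x ∈ Ũ}` for `x ≠ a₃`. -/
lemma connEvent_merge_eq_union (ends : E → Sym2 V) {a₂ a₃ x : V} (h23 : a₂ ≠ a₃) (hx : x ≠ a₃) :
    connEvent (mergeEnds ends a₃ a₂) a₂ x = connEvent ends x a₂ ∪ connEvent ends x a₃ := by
  ext ω
  simp only [mem_connEvent, Set.mem_union]
  rw [← mem_cluster, mem_cluster_merge_iff h23 hx, mem_unionCluster]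
  exact or_congr ⟨conn_symm, conn_symm⟩ ⟨conn_symm, conn_symm⟩

omit [Fintype E] [DecidableEq E] [Fintype V] in
/-- `{x ↔′ y} = {x ↔ y} ∪ ({x ∈ Ũ} ∩ {y ∈ Ũ})` for `x, y ≠ a₃`. -/
lemma connEvent_merge_eq (ends : E → Sym2 V) {a₂ a₃ x y : V} (h23 : a₂ ≠ a₃) (hx : x ≠ a₃)
    (hy : y ≠ a₃) :
    connEvent (mergeEnds ends a₃ a₂) x y = connEvent ends x y ∪
      ((connEvent ends x a₂ ∪ connEvent ends x a₃) ∩ (connEvent ends y a₂ ∪ connEvent ends y a₃)) := by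
  ext ω
  simp only [mem_connEvent, Set.mem_union, Set.mem_inter_iff]
  rw [conn_merge_iff h23 hx hy, mem_unionCluster, mem_unionCluster]
  have c : ∀ u v : V, Conn ends ω u v ↔ Conn ends ω v u := fun u v => ⟨conn_symm, conn_symm⟩
  rw [c a₂ x, c a₃ x, c a₂ y, c a₃ y]

/-- **Quantitative R10 for the union cluster** `Ũ = C(a₂) ∪ C(a₃)` (mine-2's `hquant`):
`P(o ∈ Ũ, b ∈ Ũ, a₁ ∉ Ũ) − P(o ∈ Ũ, a₁ ∉ Ũ, a₁ ↔ b) ≥ P(o ∈ Ũ | a₁ ∉ Ũ)(P(b ∈ Ũ) − P(a₁ ↔ b) − P(a₁ | b))`,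
no order hypothesis; `o, a₁, b ≠ a₃`, `a₂ ≠ a₃`. -/
theorem orderPreserving_quant_union (p : E → R) (hp : IsProbVec p) (ends : E → Sym2 V)
    {o a₁ a₂ a₃ b : V} (h23 : a₂ ≠ a₃) (ho : o ≠ a₃) (h1 : a₁ ≠ a₃) (hb : b ≠ a₃) :
    prob p ((connEvent ends o a₂ ∪ connEvent ends o a₃) ∩ (connEvent ends b a₂ ∪ connEvent ends b a₃) ∩
        (connEvent ends a₁ a₂ ∪ connEvent ends a₁ a₃)ᶜ) -
      prob p ((connEvent ends o a₂ ∪ connEvent ends o a₃) ∩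
        (connEvent ends a₁ a₂ ∪ connEvent ends a₁ a₃)ᶜ ∩ connEvent ends a₁ b) ≥
    prob p ((connEvent ends o a₂ ∪ connEvent ends o a₃) ∩ (connEvent ends a₁ a₂ ∪ connEvent ends a₁ a₃)ᶜ) /
        prob p (connEvent ends a₁ a₂ ∪ connEvent ends a₁ a₃)ᶜ *
      (prob p (connEvent ends b a₂ ∪ connEvent ends b a₃) - prob p (connEvent ends a₁ b) -
        prob p ((connEvent ends a₁ a₂ ∪ connEvent ends a₁ a₃) ∩
          (connEvent ends b a₂ ∪ connEvent ends b a₃) ∩ (connEvent ends a₁ b)ᶜ)) := by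
  have key := orderPreserving_quant p hp (mergeEnds ends a₃ a₂) a₂ o a₁ b
  rw [connEvent_merge_eq_union ends h23 ho, connEvent_merge_eq_union ends h23 hb,
    connEvent_merge_eq_union ends h23 h1, connEvent_merge_eq ends h23 h1 hb] at key
  -- on `{a₁ ∉ Ũ}` the merged connection `a₁ ↔′ b` is `a₁ ↔ b`
  have t1 : (connEvent ends o a₂ ∪ connEvent ends o a₃) ∩ (connEvent ends a₁ a₂ ∪ connEvent ends a₁ a₃)ᶜ ∩
      (connEvent ends a₁ b ∪ ((connEvent ends a₁ a₂ ∪ connEvent ends a₁ a₃) ∩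
        (connEvent ends b a₂ ∪ connEvent ends b a₃))) =
      (connEvent ends o a₂ ∪ connEvent ends o a₃) ∩ (connEvent ends a₁ a₂ ∪ connEvent ends a₁ a₃)ᶜ ∩
        connEvent ends a₁ b := by
    ext ω
    simp only [Set.mem_inter_iff, Set.mem_union, Set.mem_compl_iff]
    tauto
  -- `P(a₁ ↔′ b) = P(a₁ ↔ b) + P(a₁ | b)`
  have t2 : prob p (connEvent ends a₁ b ∪ ((connEvent ends a₁ a₂ ∪ connEvent ends a₁ a₃) ∩
      (connEvent ends b a₂ ∪ connEvent ends b a₃))) =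
      prob p (connEvent ends a₁ b) + prob p ((connEvent ends a₁ a₂ ∪ connEvent ends a₁ a₃) ∩
        (connEvent ends b a₂ ∪ connEvent ends b a₃) ∩ (connEvent ends a₁ b)ᶜ) := by
    have h := prob_union_add_prob_inter p (connEvent ends a₁ b)
      ((connEvent ends a₁ a₂ ∪ connEvent ends a₁ a₃) ∩ (connEvent ends b a₂ ∪ connEvent ends b a₃))
    have h' := prob_inter_add_prob_inter_compl p
      ((connEvent ends a₁ a₂ ∪ connEvent ends a₁ a₃) ∩ (connEvent ends b a₂ ∪ connEvent ends b a₃))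
      (connEvent ends a₁ b)
    rw [Set.inter_comm (connEvent ends a₁ b)] at h
    linarith
  -- `{a₁, b ∈ Ũ, a₁ ↮′ b} = ∅`
  have t3 : (connEvent ends a₁ a₂ ∪ connEvent ends a₁ a₃) ∩ (connEvent ends b a₂ ∪ connEvent ends b a₃) ∩
      (connEvent ends a₁ b ∪ ((connEvent ends a₁ a₂ ∪ connEvent ends a₁ a₃) ∩
        (connEvent ends b a₂ ∪ connEvent ends b a₃)))ᶜ = ∅ := by
    ext ω
    simp only [Set.mem_inter_iff, Set.mem_union, Set.mem_compl_iff, Set.mem_empty_iff_false,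
      iff_false, not_and, not_or]
    tauto
  rw [t1, t2, t3, prob_empty, sub_zero, sub_add_eq_sub_sub] at key
  exact key

end Union

end Summit.Ventures.PercRepro2
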